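import Mathlib

/-!
# Crux `TwoProducts` (stmt-5906), line `FrameRungTwo`: the combinatorial engine of the shallow-neighbour lemma (IX) —
coloured block systems with unique rainbow partitions

The `k = 2` cross-cancelling count for ALL pairs of dissociated frames is reduced (`…FrameRungTwoShallowNeighbour.lean`,
hypotheses `hIX`/`hIX'`) to the per-vertex dichotomy (IX) of `CALIBRATION-FrameRungTwo-g3.md` §3.  In the block abstraction of
(IX) (member frame with no additive coincidence among its light gaps; non-member frame arbitrary dissociated) a cross-cancelling
vertex of member depth `r = |J|` is a COLOURED BLOCK SYSTEM on the set `J` of demoted coordinates: a block is a subset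
`F ⊆ J` whose gap sum is a single letter gap of the non-member frame, its colour is that letter's coordinate; dissociation of the
non-member frame and "everything above the vertex is common" give
(A1) every proper nonempty subset of `J` has EXACTLY ONE partition into blocks of pairwise distinct colours (a rainbow partition),
(A2) `J` itself has none (the vertex is not cancelled).
This file proves the purely combinatorial engine of (IX), with no definitions: a rainbow partition of `E` by the stock of blocks
`B` (colouring `κ`) is written out as the conjunction
`P ⊆ B ∧ (∀ F ∈ P, F.Nonempty) ∧ (pairwise disjoint) ∧ P.biUnion id = E ∧ (κ injective on P)`.

* `erase_mem_of_mono` — under (A1), (A2), if `j ∈ J` is MONOCHROMATIC (every block through `j` among the proper subsets of `J`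
  has the colour of the block `{j}`), then `J \ {j}` is a block, of the colour of `{j}`;
* `complementary_pair_of_mono` — packaged with `{j} ∈ B`.

So such a vertex is the common top minus TWO gaps of ONE non-member coordinate (`γ_{J∖j}` and `γ_j`): un-demoting the letter
`j` gives a common neighbour of non-member depth `1` — the strong form of (IX).  In the geometric setting the `l`-lightest
demoted letter is monochromatic whenever the member frame has no light additive coincidence (a block `F ∋ j₀` of another colour
would make the non-member word `{γ_F, γ_{j₀}}` a cancelled point that is not a member word), which yields (IX) for such member
frames with an ARBITRARY dissociated non-member frame; the general (coincidence) case of (IX) is open — see the memo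
`Cruxes/TwoProducts/memo-IX-blocks.md` (exhaustive verification of the block statement for `|J| ≤ 5`, and of (IX) itself on
≈4·10⁵ one-dimensional faithful instances with all coincidences allowed, no exception).
Proof of `erase_mem_of_mono`: strong induction on `|J|`; with `P(J∖j) = {N, M, …}` (`N` the part of colour `κ{j}`, which exists by
(A2)), the rainbow partition of `N ∪ {j}` has a part `Z ∋ j`, `Z ≠ {j}`, `Z ≠ N ∪ {j}` (by (A1) for `N`, resp. (A2)); the block
system below `Z` satisfies (A1), (A2), so by induction `Z ∖ {j}` is a block of colour `κ{j}`, and replacing `Z` by `Z ∖ {j}`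
gives a second rainbow partition of `N` — contradiction with (A1).
Honest scope: finite combinatorics for ONE stub of a rung strictly below the crux `TwoProducts`; nothing here bears on `VP ≠ VNP`.
[ours]
-/

set_option linter.dupNamespace false

namespace Summit.ValiantsHypothesis.ValiantsHypothesis.Theorems.NewtonFramesTwoProducts.FrameRungTwoBlocks

open Finset

variable {α ι : Type*} [DecidableEq α]

section Partitions

variable {B : Finset (Finset α)} {κ : Finset α → ι} {P : Finset (Finset α)} {E F : Finset α}

/-- A part of a family with union `E` lies inside `E`. -/
theorem subset_of_biUnion_eq (hU : P.biUnion id = E) (hF : F ∈ P) : F ⊆ E := by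
  rw [← hU]
  exact Finset.subset_biUnion_of_mem id hF

/-- Every point of the union lies in some part. -/
theorem exists_mem_of_biUnion_eq (hU : P.biUnion id = E) {x : α} (hx : x ∈ E) : ∃ F ∈ P, x ∈ F := by
  rw [← hU, Finset.mem_biUnion] at hx
  simpa using hx

/-- A nonempty block is the one-part rainbow partition of itself. -/
theorem rainbow_singleton (hF : F ∈ B) (hne : F.Nonempty) :
    ({F} : Finset (Finset α)) ⊆ B ∧ (∀ G ∈ ({F} : Finset (Finset α)), G.Nonempty) ∧
      (∀ G ∈ ({F} : Finset (Finset α)), ∀ G' ∈ ({F} : Finset (Finset α)), G ≠ G' → Disjoint G G') ∧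
      ({F} : Finset (Finset α)).biUnion id = F ∧
      ∀ G ∈ ({F} : Finset (Finset α)), ∀ G' ∈ ({F} : Finset (Finset α)), κ G = κ G' → G = G' := by
  refine ⟨Finset.singleton_subset_iff.2 hF, ?_, ?_, ?_, ?_⟩
  · intro G hG; rw [Finset.mem_singleton] at hG; rw [hG]; exact hne
  · intro G hG G' hG' hne'
    rw [Finset.mem_singleton] at hG hG'
    exact absurd (hG.trans hG'.symm) hne'
  · simp
  · intro G hG G' hG' _
    rw [Finset.mem_singleton] at hG hG'
    rw [hG, hG']

/-- Removing a part `F` of a rainbow partition of `E` gives a rainbow partition of `E \ F`. -/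
theorem rainbow_erase (hPB : P ⊆ B) (hne : ∀ G ∈ P, G.Nonempty)
    (hdis : ∀ G ∈ P, ∀ G' ∈ P, G ≠ G' → Disjoint G G') (hU : P.biUnion id = E)
    (hinj : ∀ G ∈ P, ∀ G' ∈ P, κ G = κ G' → G = G') (hF : F ∈ P) :
    P.erase F ⊆ B ∧ (∀ G ∈ P.erase F, G.Nonempty) ∧
      (∀ G ∈ P.erase F, ∀ G' ∈ P.erase F, G ≠ G' → Disjoint G G') ∧ (P.erase F).biUnion id = E \ F ∧
      ∀ G ∈ P.erase F, ∀ G' ∈ P.erase F, κ G = κ G' → G = G' := by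
  refine ⟨(Finset.erase_subset F P).trans hPB, fun G hG => hne G (Finset.mem_of_mem_erase hG),
    fun G hG G' hG' hGG' => hdis G (Finset.mem_of_mem_erase hG) G' (Finset.mem_of_mem_erase hG') hGG', ?_,
    fun G hG G' hG' hk => hinj G (Finset.mem_of_mem_erase hG) G' (Finset.mem_of_mem_erase hG') hk⟩
  ext x
  simp only [Finset.mem_biUnion, id, Finset.mem_sdiff, Finset.mem_erase]
  constructor
  · rintro ⟨G, ⟨hGF, hG⟩, hxG⟩
    refine ⟨?_, fun hxF => ?_⟩
    · rw [← hU, Finset.mem_biUnion]; exact ⟨G, hG, hxG⟩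
    · exact Finset.disjoint_left.1 (hdis G hG F hF hGF) hxG hxF
  · rintro ⟨hxE, hxF⟩
    rw [← hU, Finset.mem_biUnion] at hxE
    obtain ⟨G, hG, hxG⟩ := hxE
    refine ⟨G, ⟨?_, hG⟩, hxG⟩
    rintro rfl; exact hxF hxG

/-- Adding a nonempty block `F`, disjoint from `E` and of a colour not used by `P`, to a rainbow partition `P` of `E` gives a
rainbow partition of `F ∪ E`. -/
theorem rainbow_insert (hPB : P ⊆ B) (hne : ∀ G ∈ P, G.Nonempty)
    (hdis : ∀ G ∈ P, ∀ G' ∈ P, G ≠ G' → Disjoint G G') (hU : P.biUnion id = E)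
    (hinj : ∀ G ∈ P, ∀ G' ∈ P, κ G = κ G' → G = G') (hFB : F ∈ B) (hFne : F.Nonempty) (hdisj : Disjoint F E)
    (hcol : ∀ F' ∈ P, κ F' ≠ κ F) :
    insert F P ⊆ B ∧ (∀ G ∈ insert F P, G.Nonempty) ∧
      (∀ G ∈ insert F P, ∀ G' ∈ insert F P, G ≠ G' → Disjoint G G') ∧ (insert F P).biUnion id = F ∪ E ∧
      ∀ G ∈ insert F P, ∀ G' ∈ insert F P, κ G = κ G' → G = G' := by
  have hsubE : ∀ G ∈ P, G ⊆ E := fun G hG => subset_of_biUnion_eq hU hG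
  refine ⟨Finset.insert_subset hFB hPB, ?_, ?_, ?_, ?_⟩
  · intro G hG
    rcases Finset.mem_insert.1 hG with hGF | hGP
    · rw [hGF]; exact hFne
    · exact hne G hGP
  · intro G hG G' hG' hGG'
    rcases Finset.mem_insert.1 hG with hGF | hGP <;> rcases Finset.mem_insert.1 hG' with hG'F | hG'P
    · exact absurd (hGF.trans hG'F.symm) hGG'
    · rw [hGF]; exact Finset.disjoint_of_subset_right (hsubE G' hG'P) hdisj
    · rw [hG'F]; exact Finset.disjoint_of_subset_left (hsubE G hGP) hdisj.symm
    · exact hdis G hGP G' hG'P hGG'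
  · rw [Finset.biUnion_insert, hU]; rfl
  · intro G hG G' hG' hk
    rcases Finset.mem_insert.1 hG with hGF | hGP <;> rcases Finset.mem_insert.1 hG' with hG'F | hG'P
    · rw [hGF, hG'F]
    · rw [hGF] at hk; exact absurd hk.symm (hcol G' hG'P)
    · rw [hG'F] at hk; exact absurd hk (hcol G hGP)
    · exact hinj G hGP G' hG'P hk

end Partitions

section Engine

/-- Under (A1) (every proper nonempty subset of `J` has a rainbow partition — existence suffices here) and `|J| ≥ 2`, every
singleton of `J` is a block. -/
theorem singleton_mem_of_rainbowBelow {J : Finset α} {B : Finset (Finset α)} {κ : Finset α → ι}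
    (hA1 : ∀ E, E ⊂ J → E.Nonempty → ∃ P : Finset (Finset α), P ⊆ B ∧ (∀ F ∈ P, F.Nonempty) ∧
      (∀ F ∈ P, ∀ F' ∈ P, F ≠ F' → Disjoint F F') ∧ P.biUnion id = E ∧ ∀ F ∈ P, ∀ F' ∈ P, κ F = κ F' → F = F')
    (hJ : 2 ≤ J.card) {j : α} (hj : j ∈ J) : {j} ∈ B := by
  have hss : ({j} : Finset α) ⊂ J := by
    refine Finset.ssubset_iff_subset_ne.2 ⟨Finset.singleton_subset_iff.2 hj, fun h => ?_⟩
    rw [← h, Finset.card_singleton] at hJ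
    omega
  obtain ⟨P, hPB, -, -, hU, -⟩ := hA1 {j} hss (Finset.singleton_nonempty j)
  obtain ⟨F, hF, hjF⟩ := exists_mem_of_biUnion_eq hU (Finset.mem_singleton_self j)
  have hFj : F = {j} := by
    apply Finset.eq_singleton_iff_unique_mem.2 ⟨hjF, fun x hx => ?_⟩
    exact Finset.mem_singleton.1 (subset_of_biUnion_eq hU hF hx)
  rw [← hFj]
  exact hPB hF

/-- **The engine of (IX).**  In a coloured block system (stock of blocks `B`, colouring `κ`) on a finite set `J` with `|J| ≥ 2`
in which (A1) every proper nonempty subset has exactly one rainbow partition and (A2) `J` has none: if every block through `j ∈ J`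
among the proper subsets of `J` has the colour of the block `{j}`, then `J ∖ {j}` is a block and has the colour of `{j}`.
(Stated for every `n = |J|` to run the strong induction.) [ours] -/
theorem erase_mem_of_mono : ∀ (n : ℕ) (J : Finset α) (B : Finset (Finset α)) (κ : Finset α → ι) (j : α),
    J.card = n → j ∈ J → 2 ≤ J.card →
    (∀ E, E ⊂ J → E.Nonempty → ∃ P : Finset (Finset α), (P ⊆ B ∧ (∀ F ∈ P, F.Nonempty) ∧
      (∀ F ∈ P, ∀ F' ∈ P, F ≠ F' → Disjoint F F') ∧ P.biUnion id = E ∧ ∀ F ∈ P, ∀ F' ∈ P, κ F = κ F' → F = F') ∧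
      ∀ P' : Finset (Finset α), (P' ⊆ B ∧ (∀ F ∈ P', F.Nonempty) ∧
        (∀ F ∈ P', ∀ F' ∈ P', F ≠ F' → Disjoint F F') ∧ P'.biUnion id = E ∧ ∀ F ∈ P', ∀ F' ∈ P', κ F = κ F' → F = F') →
        P' = P) →
    (∀ P : Finset (Finset α), ¬ (P ⊆ B ∧ (∀ F ∈ P, F.Nonempty) ∧
      (∀ F ∈ P, ∀ F' ∈ P, F ≠ F' → Disjoint F F') ∧ P.biUnion id = J ∧ ∀ F ∈ P, ∀ F' ∈ P, κ F = κ F' → F = F')) →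
    (∀ F ∈ B, F ⊂ J → j ∈ F → κ F = κ {j}) →
    J.erase j ∈ B ∧ κ (J.erase j) = κ {j} := by
  intro n
  induction n using Nat.strong_induction_on with
  | _ n ih =>
  intro J B κ j hn hj hJ2 hA1 hA2 hmono
  -- S0: `{j}` is a block
  have hjB : ({j} : Finset α) ∈ B := singleton_mem_of_rainbowBelow (fun E hE hEne => (hA1 E hE hEne).imp
    fun _ hP => hP.1) hJ2 hj
  -- S1: the rainbow partition `PX` of `X = J ∖ {j}` has a part `N` of colour `κ {j}`
  set X := J.erase j with hX
  have hXJ : X ⊂ J := Finset.erase_ssubset hj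
  have hXne : X.Nonempty := by
    rw [← Finset.card_pos, hX, Finset.card_erase_of_mem hj]; omega
  obtain ⟨PX, ⟨hPXB, hPXne, hPXd, hPXU, hPXi⟩, -⟩ := hA1 X hXJ hXne
  have hjX : j ∉ X := Finset.notMem_erase j J
  obtain ⟨N, hN, hNc⟩ : ∃ N ∈ PX, κ N = κ {j} := by
    by_contra hno
    push Not at hno
    have hins := rainbow_insert hPXB hPXne hPXd hPXU hPXi hjB (Finset.singleton_nonempty j)
      (Finset.disjoint_singleton_left.2 hjX) hno
    have hJ' : {j} ∪ X = J := by
      rw [hX, ← Finset.insert_eq, Finset.insert_erase hj]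
    rw [hJ'] at hins
    exact hA2 _ hins
  have hNX : N ⊆ X := subset_of_biUnion_eq hPXU hN
  have hjN : j ∉ N := fun h => hjX (hNX h)
  have hNB : N ∈ B := hPXB hN
  have hNne : N.Nonempty := hPXne N hN
  have hNJ : N ⊂ J := Finset.ssubset_of_subset_of_ssubset hNX hXJ
  -- S2: if `N` is the only part we are done
  by_cases hsingle : PX = {N}
  · have hNX' : N = X := by
      rw [hsingle, Finset.singleton_biUnion] at hPXU
      exact hPXU
    rw [← hNX']
    exact ⟨hNB, hNc⟩
  exfalso
  obtain ⟨M, hM, hMN⟩ : ∃ M ∈ PX, M ≠ N := by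
    by_contra hno
    push Not at hno
    apply hsingle
    ext F
    rw [Finset.mem_singleton]
    exact ⟨fun hF => hno F hF, fun hF => hF ▸ hN⟩
  have hMne : M.Nonempty := hPXne M hM
  have hMX : M ⊆ X := subset_of_biUnion_eq hPXU hM
  have hMNd : Disjoint M N := hPXd M hM N hN hMN
  -- S3: `E = N ∪ {j}` is a proper nonempty subset; its rainbow partition `PE` has a part `Z ∋ j`, of colour `κ {j}`
  set E := insert j N with hE
  have hEJ : E ⊂ J := by
    refine Finset.ssubset_iff_subset_ne.2 ⟨Finset.insert_subset hj hNJ.subset, fun hEJ => ?_⟩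
    obtain ⟨x, hx⟩ := hMne
    have hxJ : x ∈ J := hXJ.subset (hMX hx)
    rw [← hEJ, hE, Finset.mem_insert] at hxJ
    rcases hxJ with hxj | hxN
    · rw [hxj] at hx; exact hjX (hMX hx)
    · exact Finset.disjoint_left.1 hMNd hx hxN
  obtain ⟨PE, ⟨hPEB, hPEne, hPEd, hPEU, hPEi⟩, -⟩ := hA1 E hEJ (Finset.insert_nonempty j N)
  obtain ⟨Z, hZ, hjZ⟩ := exists_mem_of_biUnion_eq hPEU (Finset.mem_insert_self j N)
  have hZB : Z ∈ B := hPEB hZ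
  have hZE : Z ⊆ E := subset_of_biUnion_eq hPEU hZ
  have hZJ : Z ⊂ J := Finset.ssubset_of_subset_of_ssubset hZE hEJ
  have hZc : κ Z = κ {j} := hmono Z hZB hZJ hjZ
  -- uniqueness of the rainbow partition of the block `N`: any rainbow partition of `N` is `{N}`
  have hNuniq : ∀ Q : Finset (Finset α), (Q ⊆ B ∧ (∀ F ∈ Q, F.Nonempty) ∧
      (∀ F ∈ Q, ∀ F' ∈ Q, F ≠ F' → Disjoint F F') ∧ Q.biUnion id = N ∧ ∀ F ∈ Q, ∀ F' ∈ Q, κ F = κ F' → F = F') →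
      Q = {N} := by
    intro Q hQ
    obtain ⟨PN, -, hPNu⟩ := hA1 N hNJ hNne
    rw [hPNu Q hQ, ← hPNu {N} (rainbow_singleton hNB hNne)]
  -- S4: `Z ≠ {j}`
  have hZj : Z ≠ {j} := by
    intro hZj
    have hQ := rainbow_erase hPEB hPEne hPEd hPEU hPEi hZ
    have hEZ : E \ Z = N := by
      rw [hZj, hE]
      ext x
      simp only [Finset.mem_sdiff, Finset.mem_insert, Finset.mem_singleton]
      constructor
      · rintro ⟨h | h, h'⟩
        · exact absurd h h'
        · exact h
      · intro h
        exact ⟨Or.inr h, fun h' => hjN (h' ▸ h)⟩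
    rw [hEZ] at hQ
    have h1 : PE.erase Z = {N} := hNuniq _ hQ
    have hNPE : N ∈ PE := Finset.mem_of_mem_erase (by rw [h1]; exact Finset.mem_singleton_self N)
    have hZN : Z = N := hPEi Z hZ N hNPE (hZc.trans hNc.symm)
    exact hjN (hZN ▸ hjZ)
  -- S5: `Z` is not the only part of `PE`
  obtain ⟨R, hR, hRZ⟩ : ∃ R ∈ PE, R ≠ Z := by
    by_contra hno
    push Not at hno
    have hPEZ : PE = {Z} := by
      ext F
      rw [Finset.mem_singleton]
      exact ⟨fun hF => hno F hF, fun hF => hF ▸ hZ⟩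
    have hZE' : Z = E := by
      rw [hPEZ, Finset.singleton_biUnion] at hPEU
      exact hPEU
    -- then `(PX ∖ {N}) ∪ {E}` is a rainbow partition of `J`
    obtain ⟨hQB, hQne, hQd, hQU, hQi⟩ := rainbow_erase hPXB hPXne hPXd hPXU hPXi hN
    have hEB : E ∈ B := hZE' ▸ hZB
    have hdisj : Disjoint E (X \ N) := by
      rw [hE, Finset.disjoint_insert_left]
      exact ⟨fun h => hjX (Finset.mem_sdiff.1 h).1, Finset.disjoint_sdiff⟩
    have hcol : ∀ F' ∈ PX.erase N, κ F' ≠ κ E := by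
      intro F' hF' hk
      have hF'N : F' = N :=
        hPXi F' (Finset.mem_of_mem_erase hF') N hN (hk.trans ((hZE' ▸ hZc).trans hNc.symm))
      exact (Finset.mem_erase.1 hF').1 hF'N
    have hins := rainbow_insert hQB hQne hQd hQU hQi hEB (Finset.insert_nonempty j N) hdisj hcol
    have hJ' : E ∪ (X \ N) = J := by
      rw [hE, hX]
      ext x
      simp only [Finset.mem_union, Finset.mem_insert, Finset.mem_sdiff, Finset.mem_erase]
      constructor
      · rintro ((hxj | hxN) | ⟨⟨-, hxJ⟩, -⟩)
        · rw [hxj]; exact hj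
        · exact hNJ.subset hxN
        · exact hxJ
      · intro hxJ
        by_cases hxj : x = j
        · exact Or.inl (Or.inl hxj)
        · by_cases hxN : x ∈ N
          · exact Or.inl (Or.inr hxN)
          · exact Or.inr ⟨⟨hxj, hxJ⟩, hxN⟩
    rw [hJ'] at hins
    exact hA2 _ hins
  -- S6: induction inside the block `Z`, with the stock of blocks restricted to the proper subsets of `Z`
  have hZ2 : 2 ≤ Z.card := by
    by_contra hlt
    push Not at hlt
    have hZ1 : Z.card ≤ 1 := by omega
    apply hZj
    exact Finset.eq_singleton_iff_unique_mem.2 ⟨hjZ, fun x hx => Finset.card_le_one.1 hZ1 x hx j hjZ⟩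
  have hZne : Z.Nonempty := ⟨j, hjZ⟩
  set BZ := B.filter (· ⊂ Z) with hBZ
  have hA1Z : ∀ S, S ⊂ Z → S.Nonempty → ∃ P : Finset (Finset α), (P ⊆ BZ ∧ (∀ F ∈ P, F.Nonempty) ∧
      (∀ F ∈ P, ∀ F' ∈ P, F ≠ F' → Disjoint F F') ∧ P.biUnion id = S ∧ ∀ F ∈ P, ∀ F' ∈ P, κ F = κ F' → F = F') ∧
      ∀ P' : Finset (Finset α), (P' ⊆ BZ ∧ (∀ F ∈ P', F.Nonempty) ∧
        (∀ F ∈ P', ∀ F' ∈ P', F ≠ F' → Disjoint F F') ∧ P'.biUnion id = S ∧ ∀ F ∈ P', ∀ F' ∈ P', κ F = κ F' → F = F') →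
        P' = P := by
    intro S hSZ hSne
    obtain ⟨P, ⟨hPB, hPne, hPd, hPU, hPi⟩, huniq⟩ := hA1 S (Finset.ssubset_of_ssubset_of_subset hSZ hZJ.subset) hSne
    refine ⟨P, ⟨fun F hF => Finset.mem_filter.2 ⟨hPB hF, ?_⟩, hPne, hPd, hPU, hPi⟩, fun P' hP' =>
      huniq P' ⟨hP'.1.trans (Finset.filter_subset _ _), hP'.2⟩⟩
    exact Finset.ssubset_of_subset_of_ssubset (subset_of_biUnion_eq hPU hF) hSZ
  have hA2Z : ∀ P : Finset (Finset α), ¬ (P ⊆ BZ ∧ (∀ F ∈ P, F.Nonempty) ∧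
      (∀ F ∈ P, ∀ F' ∈ P, F ≠ F' → Disjoint F F') ∧ P.biUnion id = Z ∧ ∀ F ∈ P, ∀ F' ∈ P, κ F = κ F' → F = F') := by
    intro P hP
    obtain ⟨P₀, -, huniq⟩ := hA1 Z hZJ hZne
    have h1 : P = P₀ := huniq P ⟨hP.1.trans (Finset.filter_subset _ _), hP.2⟩
    have h2 : ({Z} : Finset (Finset α)) = P₀ := huniq {Z} (rainbow_singleton hZB hZne)
    have hZP : Z ∈ P := by rw [h1, ← h2]; exact Finset.mem_singleton_self Z
    have := (Finset.mem_filter.1 (hP.1 hZP)).2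
    exact (Finset.ssubset_iff_subset_ne.1 this).2 rfl
  have hmonoZ : ∀ F ∈ BZ, F ⊂ Z → j ∈ F → κ F = κ {j} := by
    intro F hF hFZ hjF
    exact hmono F (Finset.mem_filter.1 hF).1 (Finset.ssubset_of_ssubset_of_subset hFZ hZJ.subset) hjF
  have hZlt : Z.card < n := hn ▸ Finset.card_lt_card hZJ
  obtain ⟨hZmB, hZmc⟩ := ih Z.card hZlt Z BZ κ j rfl hjZ hZ2 hA1Z hA2Z hmonoZ
  have hZmB' : Z.erase j ∈ B := (Finset.mem_filter.1 hZmB).1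
  -- S7: replacing `Z` by `Z ∖ {j}` in `PE` gives a second rainbow partition of `N`
  obtain ⟨hQB, hQne, hQd, hQU, hQi⟩ := rainbow_erase hPEB hPEne hPEd hPEU hPEi hZ
  have hZm_ne : (Z.erase j).Nonempty := by
    rw [← Finset.card_pos, Finset.card_erase_of_mem hjZ]; omega
  have hdisj : Disjoint (Z.erase j) (E \ Z) :=
    Finset.disjoint_of_subset_left (Finset.erase_subset j Z) Finset.sdiff_disjoint.symm
  have hcol : ∀ F' ∈ PE.erase Z, κ F' ≠ κ (Z.erase j) := by
    intro F' hF' hk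
    have hF'Z : F' = Z := hPEi F' (Finset.mem_of_mem_erase hF') Z hZ (hk.trans (hZmc.trans hZc.symm))
    exact (Finset.mem_erase.1 hF').1 hF'Z
  have hins := rainbow_insert hQB hQne hQd hQU hQi hZmB' hZm_ne hdisj hcol
  have hN' : Z.erase j ∪ E \ Z = N := by
    rw [hE]
    ext x
    simp only [Finset.mem_union, Finset.mem_erase, Finset.mem_sdiff, Finset.mem_insert]
    constructor
    · rintro (⟨hxj, hxZ⟩ | ⟨hxj | hxN, hxZ⟩)
      · rcases Finset.mem_insert.1 (hZE hxZ) with h | h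
        · exact absurd h hxj
        · exact h
      · rw [hxj] at hxZ; exact absurd hjZ hxZ
      · exact hxN
    · intro hxN
      by_cases hxZ : x ∈ Z
      · exact Or.inl ⟨fun h => hjN (h ▸ hxN), hxZ⟩
      · exact Or.inr ⟨Or.inr hxN, hxZ⟩
  rw [hN'] at hins
  have h1 : insert (Z.erase j) (PE.erase Z) = {N} := hNuniq _ hins
  -- both `Z ∖ {j}` and `R` are parts of `{N}`, so `R = Z ∖ {j} ⊆ Z`, contradicting disjointness of the parts `R ≠ Z` of `PE`
  have hRm : R ∈ insert (Z.erase j) (PE.erase Z) := Finset.mem_insert_of_mem (Finset.mem_erase.2 ⟨hRZ, hR⟩)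
  have hZm : Z.erase j ∈ insert (Z.erase j) (PE.erase Z) := Finset.mem_insert_self _ _
  rw [h1, Finset.mem_singleton] at hRm hZm
  have hRZd : Disjoint R Z := hPEd R hR Z hZ hRZ
  obtain ⟨x, hx⟩ := hZm_ne
  have hxR : x ∈ R := by rw [hRm, ← hZm]; exact hx
  exact Finset.disjoint_left.1 hRZd hxR (Finset.erase_subset j Z hx)

/-- **Engine of (IX), packaged.**  For a coloured block system on `J` with `|J| ≥ 2` satisfying (A1) and (A2), every
monochromatic `j ∈ J` yields the complementary pair `{J ∖ {j}, {j}}` of blocks of one colour.  (In the frame setting: the vertex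
is the common top minus two letter gaps of ONE coordinate of the non-member frame, so un-demoting the letter `j` of the vertex
word gives a common point whose non-member word demotes exactly one letter — the depth-`1` case of (IX).) [ours] -/
theorem complementary_pair_of_mono {J : Finset α} {B : Finset (Finset α)} {κ : Finset α → ι} {j : α} (hj : j ∈ J)
    (hJ : 2 ≤ J.card)
    (hA1 : ∀ E, E ⊂ J → E.Nonempty → ∃ P : Finset (Finset α), (P ⊆ B ∧ (∀ F ∈ P, F.Nonempty) ∧
      (∀ F ∈ P, ∀ F' ∈ P, F ≠ F' → Disjoint F F') ∧ P.biUnion id = E ∧ ∀ F ∈ P, ∀ F' ∈ P, κ F = κ F' → F = F') ∧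
      ∀ P' : Finset (Finset α), (P' ⊆ B ∧ (∀ F ∈ P', F.Nonempty) ∧
        (∀ F ∈ P', ∀ F' ∈ P', F ≠ F' → Disjoint F F') ∧ P'.biUnion id = E ∧ ∀ F ∈ P', ∀ F' ∈ P', κ F = κ F' → F = F') →
        P' = P)
    (hA2 : ∀ P : Finset (Finset α), ¬ (P ⊆ B ∧ (∀ F ∈ P, F.Nonempty) ∧
      (∀ F ∈ P, ∀ F' ∈ P, F ≠ F' → Disjoint F F') ∧ P.biUnion id = J ∧ ∀ F ∈ P, ∀ F' ∈ P, κ F = κ F' → F = F'))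
    (hmono : ∀ F ∈ B, F ⊂ J → j ∈ F → κ F = κ {j}) :
    {j} ∈ B ∧ J.erase j ∈ B ∧ κ (J.erase j) = κ {j} :=
  ⟨singleton_mem_of_rainbowBelow (fun E hE hEne => (hA1 E hE hEne).imp fun _ hP => hP.1) hJ hj,
    erase_mem_of_mono J.card J B κ j rfl hj hJ hA1 hA2 hmono⟩

end Engine

end Summit.ValiantsHypothesis.ValiantsHypothesis.Theorems.NewtonFramesTwoProducts.FrameRungTwoBlocks
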